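import Mathlib
import Summits.Ventures.FusionMHD.Models.CerfonFreidbergIterLikeQHalfMercDefs
import HarnessLib

/-!
# Ventures/FusionMHD — Models/CerfonFreidbergIterLikeQHalfMercPanels7.lean: KERNEL CHECK of the Mercier-register certificates of panel(s) 10, 11 (of 32)
# at `ψ_N = 1/2` of THE Cerfon–Freidberg ITER-like instance

HONEST FRAMING (LADDER-GRIDFUSION three columns; CF rung; «F2.R2-CF-MERCIER-IMPLICIT» step (2), F2-SCOPING v1.6 §10(c)).  One `decide +kernel` (≈ 100 s): for each
listed panel the obligation `CFIterLike.QHalfMerc.MercCert.ok` (`Models/CerfonFreidbergIterLikeQHalfMercDefs.lean`) — the Taylor-model run of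
`progM = progA ++ block1 ++ block2 ++ block3M` over ★ #117's parameter box is ACCEPTED (both `inv` certificates included) and the kernel's FOUR panel-integral
enclosures (`g_W`, `g_Aσ`, `g_AR`, `g_B1` along the approximant) lie inside the claimed integers (read off a compiled `#eval` of the same functions, slack one unit of
`2⁻⁶⁰`; float truth inside every panel, `HOME/models/model-7/g7/genqm/truthM.json`).  MODELLED: analytic Cerfon–Freidberg family; nothing about a device or
stability.  No `native_decide`.  Typer/prover: gridfusion-model-7 (g7), 2026-08-27.
Citations: Jardin 2010 §8.5 (8.134) [Jardin2010]; Mahboubi–Melquiond–Sibut-Pinote 2016 §3.2 Lemma 3 [MahboubiMelquiondSibutpinote2016].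
-/

namespace Summit.Ventures.FusionMHD.Models.CFIterLike.QHalfMerc

/-- Mercier-register certificate data of panel(s) 10, 11. [instance data] -/
def mercCert7 : List MercCert := [
  { j := 10, cand1 := [215147609067944280064, 1215538395975900987392, 6264991461932398542848, 26121894495012161323008, 96681701038281453469696, 307074175184206374633472, 806835865355263426953216, 1481626525518381728137216, 282514889778500196106240, -27416140274102702765506560, -1495418434339976286018994176, 11538535831386091640051466240, 1898889991097974937169136975872],
    cand2 := [204191581204586430464, 883826642569488367616, 4742480823281916051456, 21282750918588683517952, 87508977060475180154880, 324664937194503089946624, 1090950016704965483954176, 3241418265851302877593600, 8322974552279077449891840, 3533508324713234687852544, -1555361788286154020879335424, 8889192698303318593181319168, 2148778927727793230674787303424],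
    deg := 10, e1 := 43, e2 := 43, wlo := -1009369131986554055, whi := -1009368952428080184, slo := 7262627036320646213, shi := 7262627695290896382,
    rlo := 10092226518940765252, rhi := 10092227455152546205, blo := 5226673719069905162, bhi := 5226674195008918453 },
  { j := 11, cand1 := [260150664824439832576, 1697049283206480920576, 9386567301462365306880, 41745757956655443607552, 157963928308492386959360, 485420680439503995797504, 1054567710941339864530944, 278672913860783484436480, -12749645725799753860513792, -94453804902512207723495424, -454808141014499099292991488, 8055424399970909795188211712, 220231231731989701964777652224],
    cand2 := [237186239408554344448, 1255032006554965508096, 7367417822088125218816, 36179935470189377748992, 158243578631423831048192, 610254813491478864592896, 2035763561575510586687488, 5401692264111620753457152, 7481778614589345285275648, -35320692995009757279420416, -384735222281965535693373440, 3120669687815599243476860928, 162201513408092265569264336896],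
    deg := 10, e1 := 43, e2 := 43, wlo := -1108522502294963599, whi := -1108522323052925822, slo := 8622481228482614113, shi := 8622481903707329858,
    rlo := 11640796741129002629, rhi := 11640797675745896266, blo := 6387304207783291776, bhi := 6387304710649773773 }]

/-- **KERNEL CHECK** of the four Mercier registers on panel(s) 10, 11. -/
theorem mercCert7_ok : CFIterLike.QHalfMerc.mercCert7.all MercCert.ok = true := by
  decide +kernel

end Summit.Ventures.FusionMHD.Models.CFIterLike.QHalfMerc
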